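import Summits.ABC.StewartYu.PadicG3ParVG
import HarnessLib

/-!
# The `p`-adic Gen-3 parameter record v2 (corrected family `…V`) — part VH: headline building blocks (m = 0)

Support file (plain theorems; no named facts). Continues `PadicG3ParVG`. The headline of the m = 0 branch reads
`8·2ⁿ·Zp + CondFloorV n ≤ C(n)·(p/log p)·Ω·W⁺`; this file supplies the algebra that removes the excess gain from
the main term, so that only logarithmic sizes remain for the successor:
* `8·2ⁿ·Zp = 2^{n+6}·(n+1)·g²·XV·LgV` (as `G = 8(n+1)·g`);
* `gⁿ·LgV ≤ 264·C_bⁿ·Ω·K + gⁿ·(2^{n+25} + (2Amax+1)/g + 4(ŜG+2) + 2)` (Siegel branch with `yloadG ≤ 11G`), hence for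
  `n ≥ 2` (so `g² ≤ gⁿ`): **`g²·LgV ≤ 264·C_bⁿ·Ω·K + gⁿ·R`**, `R := 2^{n+25} + (2Amax+1)/g + 4(ŜG+2) + 2`;
* `XV ≤ 64(n+1)·(W + log g + log LgV + 3)/G + (3/2)(n+1)·LgV·g^{n−1}/(C_bⁿΩK) + 64(n+1) + 2` (W-branch via `W_LV ≤ W + log LV + 3`,
  `LV ≤ g·LgV`);
* the D₀-branch cross term: `(3/2)(n+1)·LgV·g^{n−1}/(C_bⁿΩK) · g²·LgV`-type products are bounded using
  `gⁿ·LgV ≤ 264 C_bⁿΩK + gⁿR` twice: `g^{n+1}·LgV²/(C_bⁿΩK) ≤ (264 + gⁿR/(C_bⁿΩK))·g·LgV`.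

## References
* [Nesterenko2003] Yu. V. Nesterenko, LNM 1819 (2003) — §3.5, §5.2.
* [Yu2013] K. Yu, Acta Math. 211 (2013) — Theorem 1 (shape of the main term).
-/

noncomputable section

open Finset Real

namespace Summit.ABC.StewartYu

namespace PadicG3Par

variable {n : ℕ} (P : PadicG3Par n)

/-- the residual branches of `LgV`: `RV' = 2^{n+25} + (2Amax+1)/g + 4(ŜG+2) + 2`. [folklore] -/
def RLgV : ℝ := 2 ^ (n + 25) + (2 * P.Amax + 1) / P.g + 4 * (P.SdG + 2) + 2

/-- `0 ≤ RLgV`. [folklore] -/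
theorem RLgV_nonneg : 0 ≤ P.RLgV := by
  unfold RLgV
  have hA0 : 0 ≤ P.Amax := le_trans (P.A_pos ⟨0, by have := P.hn; omega⟩).le (P.hAmax _)
  have hg : 0 < P.g := lt_of_lt_of_le one_pos P.one_le_g
  positivity

/-- **`8·2ⁿ·Zp = 2^{n+6}·(n+1)·g²·XV·LgV`**. [folklore] -/
theorem eight_two_pow_Zp_eq : 8 * 2 ^ n * P.Zp = 2 ^ (n + 6) * (n + 1) * P.g ^ 2 * P.XV * P.LgV := by
  have hG := P.G_eq_mul_g
  unfold Zp; rw [hG, pow_add]; ring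

/-- **`gⁿ·LgV ≤ 264·C_bⁿ·Ω·K + gⁿ·RLgV`** (under `½ ≤ θ₀`, `N_q ≤ 2ⁿK`: `yloadG ≤ 11 G`). [folklore] -/
theorem g_pow_mul_LgV_le (hθ : 1 / 2 ≤ P.θ₀) (hNqK : P.Nq ≤ 2 ^ n * P.K) :
    P.g ^ n * P.LgV ≤ 264 * Cb ^ n * P.Ω * P.K + P.g ^ n * P.RLgV := by
  have hL := P.LgV_le
  have hy := P.yloadG_le_eleven_G hθ hNqK
  have hG : 0 < P.G := by linarith [P.eight_le_G]
  have hg : 0 < P.g := lt_of_lt_of_le one_pos P.one_le_g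
  have hgn : 0 < P.g ^ n := pow_pos hg n
  have hc : 0 ≤ 24 * Cb ^ n * P.Ω * P.K := by
    have := P.Ω_pos; have := P.K_pos; have : (0:ℝ) < Cb := Cb_pos
    positivity
  -- the Siegel branch times `gⁿ`: `24 C_bⁿΩK yloadG/G ≤ 264 C_bⁿΩK`
  have h1 : P.g ^ n * (24 * Cb ^ n * P.Ω * P.K * P.yloadG / (P.G * P.g ^ n)) = 24 * Cb ^ n * P.Ω * P.K * (P.yloadG / P.G) := by
    field_simp
  have h2 : P.yloadG / P.G ≤ 11 := by rw [div_le_iff₀ hG]; linarith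
  have h3 : 24 * Cb ^ n * P.Ω * P.K * (P.yloadG / P.G) ≤ 264 * Cb ^ n * P.Ω * P.K := by nlinarith
  have h4 := mul_le_mul_of_nonneg_left hL hgn.le
  have e : P.g ^ n * (24 * Cb ^ n * P.Ω * P.K * P.yloadG / (P.G * P.g ^ n) + 2 ^ (n + 25) + (2 * P.Amax + 1) / P.g +
      4 * (P.SdG + 2) + 2) = P.g ^ n * (24 * Cb ^ n * P.Ω * P.K * P.yloadG / (P.G * P.g ^ n)) + P.g ^ n * P.RLgV := by
    unfold RLgV; ring
  rw [e, h1] at h4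
  linarith

/-- `g² ≤ gⁿ` for `n ≥ 2` (`g ≥ 1`). [folklore] -/
theorem g_sq_le_g_pow (hn2 : 2 ≤ n) : P.g ^ 2 ≤ P.g ^ n := pow_le_pow_right₀ P.one_le_g hn2

/-- **`g²·LgV ≤ 264·C_bⁿ·Ω·K + gⁿ·RLgV`** for `n ≥ 2`. [folklore] -/
theorem g_sq_mul_LgV_le (hn2 : 2 ≤ n) (hθ : 1 / 2 ≤ P.θ₀) (hNqK : P.Nq ≤ 2 ^ n * P.K) :
    P.g ^ 2 * P.LgV ≤ 264 * Cb ^ n * P.Ω * P.K + P.g ^ n * P.RLgV := by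
  have h := P.g_pow_mul_LgV_le hθ hNqK
  have hL : (0 : ℝ) ≤ P.LgV := by positivity
  have := mul_le_mul_of_nonneg_right (P.g_sq_le_g_pow hn2) hL
  linarith

/-- `log LV ≤ log g + log LgV`. [folklore] -/
theorem log_LV_le : Real.log P.LV ≤ Real.log P.g + Real.log P.LgV := by
  have h := P.LV_le_g_mul_LgV
  have hg : 0 < P.g := lt_of_lt_of_le one_pos P.one_le_g
  have hL : (0 : ℝ) < P.LgV := by linarith [P.one_le_LgV]
  have hLV : (0 : ℝ) < P.LV := by linarith [P.one_le_LV]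
  rw [← Real.log_mul hg.ne' hL.ne']
  exact Real.log_le_log hLV h

/-- **`XV ≤ 64(n+1)(W + log g + log LgV + 3)/G + (3/2)(n+1)LgV·g^{n−1}/(C_bⁿΩK) + 64(n+1) + 2`**. [folklore] -/
theorem XV_le' : (P.XV : ℝ) ≤ 64 * (n + 1) * (P.W + Real.log P.g + Real.log P.LgV + 3) / P.G +
    (3 / 2) * (n + 1) * P.LgV * P.g ^ (n - 1) / (Cb ^ n * P.Ω * P.K) + 64 * (n + 1) + 2 := by
  have h1 := P.XV_le
  have h2 := P.WLV_le
  have h3 := P.log_LV_le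
  have hG : 0 < P.G := by linarith [P.eight_le_G]
  have h4 : 64 * (n + 1) * P.WLV / P.G ≤ 64 * (n + 1) * (P.W + Real.log P.g + Real.log P.LgV + 3) / P.G := by
    apply div_le_div_of_nonneg_right _ hG.le
    apply mul_le_mul_of_nonneg_left _ (by positivity)
    linarith
  linarith

/-- the D₀-branch cross term: `g^{n+1}·LgV² /(C_bⁿΩK) ≤ (264 + gⁿ·RLgV/(C_bⁿΩK))·g·LgV`. [folklore] -/
theorem cross_term_le (hθ : 1 / 2 ≤ P.θ₀) (hNqK : P.Nq ≤ 2 ^ n * P.K) :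
    P.g ^ (n + 1) * P.LgV ^ 2 / (Cb ^ n * P.Ω * P.K) ≤ (264 + P.g ^ n * P.RLgV / (Cb ^ n * P.Ω * P.K)) * (P.g * P.LgV) := by
  have h := P.g_pow_mul_LgV_le hθ hNqK
  have hg : 0 < P.g := lt_of_lt_of_le one_pos P.one_le_g
  have hL : (0 : ℝ) ≤ P.LgV := by positivity
  have hc : 0 < Cb ^ n * P.Ω * P.K := by
    have := P.Ω_pos; have := P.K_pos; have : (0:ℝ) < Cb := Cb_pos
    positivity
  have hgL : 0 ≤ P.g * P.LgV := by positivity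
  -- divide `h` by `C_bⁿΩK` and multiply by `g LgV`
  have h1 : P.g ^ n * P.LgV / (Cb ^ n * P.Ω * P.K) ≤ 264 + P.g ^ n * P.RLgV / (Cb ^ n * P.Ω * P.K) := by
    rw [div_le_iff₀ hc]
    have e : (264 + P.g ^ n * P.RLgV / (Cb ^ n * P.Ω * P.K)) * (Cb ^ n * P.Ω * P.K) =
        264 * Cb ^ n * P.Ω * P.K + P.g ^ n * P.RLgV := by
      rw [add_mul, div_mul_cancel₀ _ hc.ne']; ring
    rw [e]; exact h
  have h2 := mul_le_mul_of_nonneg_right h1 hgL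
  have e2 : P.g ^ n * P.LgV / (Cb ^ n * P.Ω * P.K) * (P.g * P.LgV) = P.g ^ (n + 1) * P.LgV ^ 2 / (Cb ^ n * P.Ω * P.K) := by
    rw [pow_succ]; field_simp
  rw [e2] at h2
  exact h2

end PadicG3Par

end Summit.ABC.StewartYu
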